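import Mathlib
import Summits.CriticalPhenomena.PercolationContinuityZ3.Theorems.PercNearOneGluingNoHeavyLowerTailGameCount
import HarnessLib
import HarnessLib.Audit

/-!
# The Marica–Schönheim certificate for K♯: a pairwise-close family of debtors is at most the anti-donors

Support file for crux `stmt-CriticalPhenomena-4575` (`NoHeavyLowerTail`, route `PercNearOneGluingNoHeavy`), hull-port seat `prim-hp-7`
(generation 85); `--supports stmt-CriticalPhenomena-4575`.  No `sorry`.
Memo `run/shared/lean/prim/prim-hp-7/FROM-prim-hp-7-g85-MS-AND-AD-CERTIFICATES.md` §1.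

**Setting** (`GeneratedDonors`, file `…LowerTailMSSharp`): monotone labellings `g h : Finset α → Lab 3`; `debtors g h` = charged and
uncredited sets; `Linked g h (univ \ q) s` ('`q` is close to `s`') makes `q \ s` an anti-donor (Lemma A,
`good_compl_and_null_of_close`); `genSharp g h` = the family of such close differences of debtors.

* `diffs_subset_genSharp_of_close` — if `H ⊆ debtors` is PAIRWISE CLOSE (every ordered pair `(q, s) ∈ H × H` is close) then the whole
  difference family `H \\ H = {q \ s}` lies in `genSharp g h`.
* `card_le_card_genSharp_of_close` — hence `#H ≤ #(genSharp g h)` by the **Marica–Schönheim inequality** `#H ≤ #(H \\ H)`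
  (`Finset.card_le_card_diffs`).  In particular every single hexagon value class `D(x,y)` of debtors is pairwise close, so each class
  alone is at most the anti-donors.
* `kSharp_ineq_of_close_half` — **MS certificate**: if some pairwise-close `H ⊆ debtors` carries at least half of the debtors
  (`#debtors ≤ 2 #H`, e.g. `H` contains one set of every debtor pair `{q, qᶜ}`), then the K♯ inequality `#charged ≤ #credited` holds at
  `(g, h)` (via `kSharp_ineq_of_msSharp_ineq`).  Existence of such an `H` is a 2-SAT condition on the debtor pairs; it holds for
  905/910, 749/756, 244/250 random planted maps on `2^4, 2^5, 2^6` but fails on the gen-83/84 hard instances (memo §1: at most 12 of the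
  24 unordered debtor value types can be oriented pairwise close) — a certificate kind different from sectioning / game domination.
-/

namespace Summit.CriticalPhenomena.PercolationContinuityZ3.Theorems

namespace GeneratedDonors

open Finset FinsetFamily OrientedAntipodalHall AntipodalStrongHarris AntipodalStrongHarris.Lab

variable {α : Type} [Fintype α] [DecidableEq α]

/-- A pairwise-close family of debtors generates all its differences: `H \\ H ⊆ genSharp g h`. -/
theorem diffs_subset_genSharp_of_close (g h : Finset α → Lab 3) {H : Finset (Finset α)}
    (hH : H ⊆ debtors g h) (hclose : ∀ q ∈ H, ∀ s ∈ H, Linked g h (univ \ q) s) :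
    H \\ H ⊆ genSharp g h := by
  rw [diffs_subset_iff]
  intro q hq s hs
  exact mem_genSharp.mpr ⟨q, hH hq, s, hH hs, hclose q hq s hs, rfl⟩

/-- **Marica–Schönheim bound for a close family.**  A pairwise-close family of debtors is at most as large as the generated
family of anti-donors: `#H ≤ #(H \\ H) ≤ #(genSharp g h)`. -/
theorem card_le_card_genSharp_of_close (g h : Finset α → Lab 3) {H : Finset (Finset α)}
    (hH : H ⊆ debtors g h) (hclose : ∀ q ∈ H, ∀ s ∈ H, Linked g h (univ \ q) s) :
    #H ≤ #(genSharp g h) :=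
  (Finset.card_le_card_diffs H).trans (card_le_card (diffs_subset_genSharp_of_close g h hH hclose))

/-- A pairwise-close family of debtors is at most as large as the resolved family's anti-donor half: `#H ≤ #(resolved g h)`
(for monotone `g, h`, through `genSharp ⊆ resolved`). -/
theorem card_le_card_resolved_of_close (g h : Finset α → Lab 3)
    (hg : ∀ ⦃X Y : Finset α⦄, X ⊆ Y → g X ≤ g Y) (hh : ∀ ⦃X Y : Finset α⦄, X ⊆ Y → h X ≤ h Y)
    {H : Finset (Finset α)} (hH : H ⊆ debtors g h) (hclose : ∀ q ∈ H, ∀ s ∈ H, Linked g h (univ \ q) s) :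
    #H ≤ #(resolved g h) :=
  (card_le_card_genSharp_of_close g h hH hclose).trans (card_le_card (genSharp_subset_resolved g h hg hh))

/-- **The MS certificate for K♯** (hp-7 gen 85).  If a pairwise-close family `H` of debtors carries at least half of the debtor sets
(`#debtors ≤ 2 · #H`; e.g. `H` meets every debtor pair `{q, qᶜ}`), then the K♯ inequality holds at `(g, h)`:
`#H ≤ #(H \\ H)` (Marica–Schönheim), `H \\ H ⊆ genSharp` (Lemma A), and `#debtors ≤ 2 #genSharp` suffices (`kSharp_ineq_of_msSharp_ineq`). -/
theorem kSharp_ineq_of_close_half (g h : Finset α → Lab 3)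
    (hg : ∀ ⦃X Y : Finset α⦄, X ⊆ Y → g X ≤ g Y) (hh : ∀ ⦃X Y : Finset α⦄, X ⊆ Y → h X ≤ h Y)
    (H : Finset (Finset α)) (hH : H ⊆ debtors g h) (hclose : ∀ q ∈ H, ∀ s ∈ H, Linked g h (univ \ q) s)
    (hhalf : #(debtors g h) ≤ 2 * #H) :
    #{q ∈ (univ : Finset (Finset α)) | IsCharged 3 g h q} ≤
      #{q ∈ (univ : Finset (Finset α)) | (g q = top ∧ h (univ \ q) = bot) ∨ (g (univ \ q) = top ∧ h q = bot)} :=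
  kSharp_ineq_of_msSharp_ineq g h hg hh (hhalf.trans (Nat.mul_le_mul_left 2 (card_le_card_genSharp_of_close g h hH hclose)))

/-- The 'half' hypothesis from a transversal: if every debtor set is in `H` or has its complement in `H`, then `#debtors ≤ 2 #H`. -/
theorem card_debtors_le_two_mul_of_transversal (g h : Finset α → Lab 3) (H : Finset (Finset α))
    (hcover : ∀ q ∈ debtors g h, q ∈ H ∨ univ \ q ∈ H) : #(debtors g h) ≤ 2 * #H := by
  classical
  have hcc : ∀ q : Finset α, univ \ (univ \ q) = q := fun q => by
    rw [Finset.sdiff_sdiff_eq_self (subset_univ q)]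
  have hsub : debtors g h ⊆ H ∪ H.image (fun q => univ \ q) := by
    intro q hq
    rcases hcover q hq with h1 | h1
    · exact mem_union_left _ h1
    · exact mem_union_right _ (mem_image.mpr ⟨univ \ q, h1, hcc q⟩)
  calc #(debtors g h) ≤ #(H ∪ H.image (fun q => univ \ q)) := card_le_card hsub
    _ ≤ #H + #(H.image (fun q => univ \ q)) := card_union_le _ _
    _ ≤ #H + #H := Nat.add_le_add_left card_image_le _
    _ = 2 * #H := by ring

/-- **MS certificate, transversal form**: a pairwise-close family of debtors meeting every debtor pair `{q, qᶜ}` certifies the K♯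
inequality at `(g, h)`. -/
theorem kSharp_ineq_of_close_transversal (g h : Finset α → Lab 3)
    (hg : ∀ ⦃X Y : Finset α⦄, X ⊆ Y → g X ≤ g Y) (hh : ∀ ⦃X Y : Finset α⦄, X ⊆ Y → h X ≤ h Y)
    (H : Finset (Finset α)) (hH : H ⊆ debtors g h) (hclose : ∀ q ∈ H, ∀ s ∈ H, Linked g h (univ \ q) s)
    (hcover : ∀ q ∈ debtors g h, q ∈ H ∨ univ \ q ∈ H) :
    #{q ∈ (univ : Finset (Finset α)) | IsCharged 3 g h q} ≤
      #{q ∈ (univ : Finset (Finset α)) | (g q = top ∧ h (univ \ q) = bot) ∨ (g (univ \ q) = top ∧ h q = bot)} :=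
  kSharp_ineq_of_close_half g h hg hh H hH hclose (card_debtors_le_two_mul_of_transversal g h H hcover)

end GeneratedDonors

end Summit.CriticalPhenomena.PercolationContinuityZ3.Theorems
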